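import Literature.NumberTheory.GaloisRepresentations.IndexCoprimeTransfer
import Literature.NumberTheory.GaloisRepresentations.PPrimaryDevissage
import Mathlib.GroupTheory.Sylow
import HarnessLib

/-!
# `cd_p(G) ≤ n` from the OPEN subgroups: `H^{n+1}(U, ℤ/p) = 0` for every open `U ≤ G` (Serre I §3.3
# Cor. 1 of Prop. 14 with I §3.1 Prop. 11 and I §4.1 Prop. 21, in the Sylow-free form)

Topic `NumberTheory/GaloisRepresentations`; namespace `Literature.NumberTheory.GaloisRepresentations`.
THEOREMS ONLY (no definition, no named fact, no `sorry`, no instance; D-0026).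

Serre, *Cohomologie galoisienne*, I §3.3 Cor. 1 of Prop. 14: "`cd_p(G) = cd_p(G_p)`" for a Sylow
`p`-subgroup `G_p`; I §4.1 Prop. 21: for a pro-`p`-group, "`cd_p(G) ≤ n` ⟺ `H^{n+1}(G, ℤ/pℤ) = 0`";
I §3.1 Prop. 11: `cd_p(G) ≤ n` ⟺ `H^{n+1}(G, A) = 0` for every discrete `p`-primary torsion `A`.
Together (with `H^{n+1}(G_p, ℤ/p) = lim→ H^{n+1}(U, ℤ/p)` over the open `U ⊇ G_p`, I §2.2 Prop. 8):
**if `H^{n+1}(U, ℤ/p) = 0` for every OPEN subgroup `U` of the profinite group `G`, then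
`cd_p(G) ≤ n`.**  This is the criterion by which Neukirch–Schmidt–Wingberg prove (8.3.18)
`cd_p(G_S) ≤ 2` ("it suffices to show `H³(G_S(K'), μ_p) = 0` for all finite `K' ⊆ k_S` containing
`μ_p`", via (3.3.2)/(3.3.5)), and the form needed by lane «PT3-TC» of cell `bsd-eis` (crux
`GoodLatticeBDPValue`, stmt-BirchSwinnertonDyer-19032: Harari Thm. 17.13 (a) at a totally complex
field ⟸ `cd_ℓ(G_{K,S}) ≤ 2`, `RestrictedRamificationPoitouTateThreeLeOfCdTwo.lean`).

The proof here is the tree's Sylow-free route of `CohomologicalDimensionTsenProofs.lean`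
(`subsingleton_two_of_finite`, there in degree `2` for `Γ_k`), made abstract and in every degree:
* reduce to FINITE `p`-primary `B` (`subsingleton_of_forall_finite`, Serre I §2.2 Cor. 2);
* `B` is trivial on an OPEN NORMAL `N₀` (the kernel of the action: it contains the finite
  intersection of the open stabilisers); with a Sylow `p`-subgroup `P` of the finite `G/N₀` and its
  open preimage `U` (index `(G/N₀ : P)` prime to `p`) one DESCENDS to `U`
  (`subsingleton_of_isOpen_of_index_coprime`: `B` is a retract of `M_G^U(B)`, Shapiro);
* `U` acts on `B` through the `p`-group `P`, so dévissage through fixed lines `ℤ/p ⊆ B`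
  (`subsingleton_succ_of_pGroup_quotient`, the degree-`n+1` twin of the tree's
  `subsingleton_two_of_pGroup_quotient`) reduces to `H^{n+1}(U, W) = 0` for `W` of order `p` with
  TRIVIAL action — the hypothesis;
* `cd_p(G) ≤ n` by Serre I §3.1 Prop. 11 (`groupCdLE_of_forall_subsingleton`, dimension shifting).

## What is formalised (`G` compact Hausdorff totally disconnected, `p` prime)

* `subsingleton_succ_of_pGroup_quotient` — dévissage over a `p`-extension in degree `n + 1`;
* `subsingleton_succ_of_finite_of_forall_isOpen` — `H^{n+1}(G, B) = 0` for finite `p`-primary `B`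
  from the open-subgroup hypothesis;
* **`groupCdLE_of_forall_isOpen_subsingleton_trivial`** — the criterion: `GroupCdLE G p n`.

## References

* J.-P. Serre, *Cohomologie galoisienne*, 5e éd., LNM 5 (1994) / *Galois Cohomology* (1997),
  I §2.2 Prop. 8 and Cor. 2, I §3.1 Prop. 11, I §3.3 Prop. 14 and Cor. 1, I §4.1 Prop. 21.
  [SerreGaloisCohomology1997]
* J. Neukirch, A. Schmidt, K. Wingberg, *Cohomology of Number Fields*, 2nd ed. (2008), (3.3.2),
  (3.3.5), proof of (8.3.18). [NeukirchSchmidtWingberg2008]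
* S. S. Shatz, *Profinite groups, arithmetic, and geometry* (1972), Ch. III §1. [Shatz1972]
-/

noncomputable section

open CategoryTheory Topology Filter

universe u

namespace Literature.NumberTheory.GaloisRepresentations

open _root_.TopRep _root_.ContRepresentation _root_.ContinuousCohomology

/-! ### §1. Dévissage over a `p`-extension, in degree `n + 1` -/

section Devissage

variable {G : Type u} [Group G] [TopologicalSpace G] [IsTopologicalGroup G] [CompactSpace G]

/-- **Dévissage over a `p`-extension, degree `n + 1`**: if `G/N₀` is a finite `p`-group and
`H^{n+1}(G, W) = 0` for all finite `W` of order `p` with trivial action, then `H^{n+1}(G, B) = 0` for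
every finite discrete `p`-primary `B` on which `N₀` acts trivially (induction on `|B|` through a
fixed line `ℤ/p ⊆ B`: a `p`-group acting on a non-zero `p`-group has a non-zero fixed vector).  The
degree-`2` case is the tree's `subsingleton_two_of_pGroup_quotient`, whose proof this repeats.
[cite: SerreGaloisCohomology1997, I §3.3 Cor. 1 and I §4.1 Prop. 21 (proof)] -/
theorem subsingleton_succ_of_pGroup_quotient {p : ℕ} [hp : Fact p.Prime] (n : ℕ) (N₀ : Subgroup G)
    [N₀.Normal] [Finite (G ⧸ N₀)] (hQ : IsPGroup p (G ⧸ N₀))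
    (hP : ∀ (W : Type u) [AddCommGroup W] [TopologicalSpace W] [DiscreteTopology W] [Finite W]
      (σ : ContinuousRep G ℤ W), (∀ (g : G) (w : W), σ g w = w) → Nat.card W = p →
        Subsingleton (continuousCohomology (n + 1) σ.toTopRep))
    (B : Type u) [AddCommGroup B] [TopologicalSpace B] [DiscreteTopology B] [Finite B]
    (τ : ContinuousRep G ℤ B) (hB : IsPrimaryTorsion p B) (hN₀ : ∀ g ∈ N₀, ∀ b : B, τ g b = b) :
    Subsingleton (continuousCohomology (n + 1) τ.toTopRep) := by
  classical
  suffices key : ∀ (m : ℕ) (B : Type u) [AddCommGroup B] [TopologicalSpace B] [DiscreteTopology B]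
      [Finite B] (τ : ContinuousRep G ℤ B), IsPrimaryTorsion p B →
      (∀ g ∈ N₀, ∀ b : B, τ g b = b) → Nat.card B = m →
      Subsingleton (continuousCohomology (n + 1) τ.toTopRep) from key _ B τ hB hN₀ rfl
  intro m
  induction m using Nat.strong_induction_on with
  | _ m ih =>
    intro B _ _ _ _ τ hB hN₀ hm
    by_cases hsub : Subsingleton B
    · exact subsingleton_continuousCohomology_of_subsingleton τ.toTopRep n
    · haveI : Nontrivial B := not_subsingleton_iff_nontrivial.1 hsub
      obtain ⟨b, hb0, hbfix⟩ := exists_ne_zero_forall_apply_eq N₀ hQ τ hB hN₀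
      obtain ⟨b₁, hb₁0, hpb₁, hb₁fix⟩ := exists_line τ hB b hb0 hbfix
      let W₁ : Submodule ℤ B := Submodule.span ℤ {b₁}
      have hW₁ : ∀ g, W₁ ≤ W₁.comap (τ g) := span_singleton_le_comap τ b₁ hb₁fix
      have hSES := isSES_subtype_mkQ τ W₁ hW₁
      have hcardW : Nat.card W₁ = p := natCard_span_singleton b₁ hb₁0 hpb₁
      -- the line
      have h₁ : Subsingleton (continuousCohomology (n + 1) (τ.subrepresentation W₁ hW₁).toTopRep) :=
        hP W₁ (τ.subrepresentation W₁ hW₁) (subrepresentation_span_apply τ b₁ hb₁fix) hcardW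
      -- the quotient, by induction
      haveI : Finite (B ⧸ W₁) := Finite.of_surjective _ (Submodule.Quotient.mk_surjective W₁)
      have hlt : Nat.card (B ⧸ W₁) < m := by
        have hmul : Nat.card B = Nat.card (B ⧸ W₁) * Nat.card W₁ :=
          AddSubgroup.card_eq_card_quotient_mul_card_addSubgroup W₁.toAddSubgroup
        rw [hm, hcardW] at hmul
        rw [hmul]
        exact (Nat.lt_mul_iff_one_lt_right Nat.card_pos).2 hp.out.one_lt
      have htriv : ∀ g ∈ N₀, ∀ x : B ⧸ W₁, τ.quotient W₁ hW₁ g x = x := fun g hg x => by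
        induction x using Submodule.Quotient.induction_on with
        | _ b' => rw [ContinuousRep.quotient_apply_mk, hN₀ g hg b']
      have h₃ : Subsingleton (continuousCohomology (n + 1) (τ.quotient W₁ hW₁).toTopRep) :=
        ih _ hlt (B ⧸ W₁) (τ.quotient W₁ hW₁) (hB.quotient W₁) htriv rfl
      exact hSES.subsingleton_X₂ n h₁ h₃

end Devissage

/-! ### §2. The criterion -/

section Criterion

variable {G : Type u} [Group G] [TopologicalSpace G] [IsTopologicalGroup G] [CompactSpace G]
  [T2Space G] [TotallyDisconnectedSpace G]

/-- **`H^{n+1}(G, B) = 0` for every finite discrete `p`-primary `G`-module `B`**, granted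
`H^{n+1}(U, W) = 0` for every OPEN subgroup `U ≤ G` and every finite `W` of order `p` with trivial
`U`-action.  `B` is trivial on the open normal kernel `N₀` of the action; with a Sylow `p`-subgroup
`P` of the finite `G/N₀` and its open preimage `U` (index prime to `p`) it suffices to treat `U`
(`subsingleton_of_isOpen_of_index_coprime`: restriction to a subgroup of index prime to `p` is
injective on `p`-primary cohomology), which acts on `B` through the `p`-group `P`, so the dévissage
`subsingleton_succ_of_pGroup_quotient` applies.
[cite: SerreGaloisCohomology1997, I §3.3 Prop. 14 and Cor. 1, I §4.1 Prop. 21]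
[cite: NeukirchSchmidtWingberg2008, (3.3.2) and (3.3.5)] -/
theorem subsingleton_succ_of_finite_of_forall_isOpen {p : ℕ} [hp : Fact p.Prime] (n : ℕ)
    (h : ∀ (U : Subgroup G), IsOpen (U : Set G) →
      ∀ (W : Type u) [AddCommGroup W] [TopologicalSpace W] [DiscreteTopology W] [Finite W]
        (σ : ContinuousRep U ℤ W), (∀ (g : U) (w : W), σ g w = w) → Nat.card W = p →
        Subsingleton (continuousCohomology (n + 1) σ.toTopRep))
    (B : Type u) [AddCommGroup B] [TopologicalSpace B] [DiscreteTopology B] [Finite B]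
    (τ : ContinuousRep G ℤ B) (hB : IsPrimaryTorsion p B) :
    Subsingleton (continuousCohomology (n + 1) τ.toTopRep) := by
  classical
  -- the kernel of the action is an open normal subgroup
  let N₀ : Subgroup G := τ.toRepresentation.ker
  haveI : N₀.Normal := MonoidHom.normal_ker _
  have hN₀ : ∀ g ∈ N₀, ∀ b : B, τ g b = b := fun g hg b => by
    have hg' : τ.toRepresentation g = 1 := MonoidHom.mem_ker.1 hg
    rw [← ContinuousRep.toRepresentation_apply, hg']
    rfl
  have hN₀open : IsOpen (N₀ : Set G) := by
    refine Subgroup.isOpen_of_mem_nhds N₀ (g := 1) (Filter.mem_of_superset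
      ((Filter.iInter_mem).2 fun b : B => τ.setOf_apply_eq_mem_nhds_one b) fun g hg => ?_)
    rw [SetLike.mem_coe, MonoidHom.mem_ker]
    ext b
    rw [ContinuousRep.toRepresentation_apply]
    exact Set.mem_iInter.1 hg b
  haveI : Finite (G ⧸ N₀) := Subgroup.quotient_finite_of_isOpen N₀ hN₀open
  -- a Sylow `p`-subgroup of `G/N₀` and its open preimage `U`, of index prime to `p`
  obtain ⟨P⟩ := (Sylow.nonempty : Nonempty (Sylow p (G ⧸ N₀)))
  let U : Subgroup G := (P : Subgroup (G ⧸ N₀)).comap (QuotientGroup.mk' N₀)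
  have hNU : N₀ ≤ U := fun g hg => by
    rw [Subgroup.mem_comap, QuotientGroup.mk'_apply, (QuotientGroup.eq_one_iff g).2 hg]
    exact one_mem _
  have hUopen : IsOpen (U : Set G) := Subgroup.isOpen_mono hNU hN₀open
  haveI : CompactSpace U :=
    isCompact_iff_compactSpace.mp (Subgroup.isClosed_of_isOpen U hUopen).isCompact
  have hUidx : U.index.Coprime p := by
    rw [Subgroup.index_comap_of_surjective _ (QuotientGroup.mk'_surjective N₀)]
    exact ((Nat.Prime.coprime_iff_not_dvd hp.out).2 P.not_dvd_index).symm
  refine subsingleton_of_isOpen_of_index_coprime τ hB hUopen hUidx n ?_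
  -- `U` acts on `B` through the `p`-group `P`
  let φ : U →* (P : Subgroup (G ⧸ N₀)) :=
    ((QuotientGroup.mk' N₀).comp U.subtype).codRestrict _ fun u => Subgroup.mem_comap.1 u.2
  haveI : Finite (U ⧸ φ.ker) :=
    Finite.of_injective (QuotientGroup.kerLift φ) (QuotientGroup.kerLift_injective φ)
  have hQ : IsPGroup p (U ⧸ φ.ker) :=
    P.isPGroup'.of_injective (QuotientGroup.kerLift φ) (QuotientGroup.kerLift_injective φ)
  have hker : ∀ g ∈ φ.ker, ∀ b : B, (τ.restrict (subgroupIncl U)) g b = b := by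
    intro g hg b
    rw [MonoidHom.mem_ker] at hg
    have h1 : ((g : G) : G ⧸ N₀) = 1 :=
      congrArg (fun x : (P : Subgroup (G ⧸ N₀)) => (x : G ⧸ N₀)) hg
    rw [ContinuousRep.restrict_apply, subgroupIncl_apply]
    exact hN₀ _ ((QuotientGroup.eq_one_iff _).1 h1) b
  exact subsingleton_succ_of_pGroup_quotient n φ.ker hQ
    (fun W _ _ _ _ σ hσ hW => h U hUopen W σ hσ hW) B (τ.restrict (subgroupIncl U)) hB hker

/-- **Serre I §3.3 Cor. 1 ∘ I §4.1 Prop. 21 ∘ I §3.1 Prop. 11, Sylow-free: `cd_p(G) ≤ n` from the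
open subgroups.**  For a profinite (compact Hausdorff totally disconnected) group `G`, a prime `p`
and `n : ℕ`: if `H^{n+1}(U, W) = 0` for every OPEN subgroup `U ≤ G` and every finite discrete
`U`-module `W` of order `p` with TRIVIAL action (i.e. `H^{n+1}(U, ℤ/p) = 0`), then `cd_p(G) ≤ n`
(`GroupCdLE G p n`: `H^q(G, A) = 0` for all `q > n` and all discrete `p`-primary torsion `A`).
[cite: SerreGaloisCohomology1997, I §3.1 Prop. 11, I §3.3 Cor. 1, I §4.1 Prop. 21]
[cite: NeukirchSchmidtWingberg2008, (3.3.2) and (3.3.5), proof of (8.3.18)] -/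
theorem groupCdLE_of_forall_isOpen_subsingleton_trivial {p : ℕ} [hp : Fact p.Prime] {n : ℕ}
    (h : ∀ (U : Subgroup G), IsOpen (U : Set G) →
      ∀ (W : Type u) [AddCommGroup W] [TopologicalSpace W] [DiscreteTopology W] [Finite W]
        (σ : ContinuousRep U ℤ W), (∀ (g : U) (w : W), σ g w = w) → Nat.card W = p →
        Subsingleton (continuousCohomology (n + 1) σ.toTopRep)) :
    GroupCdLE G p n :=
  groupCdLE_of_forall_subsingleton fun _ _ _ _ ρ hM =>
    subsingleton_of_forall_finite ρ hp.out.ne_zero n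
      (fun B _ _ _ _ τ hB => subsingleton_succ_of_finite_of_forall_isOpen n h B τ hB) hM

end Criterion

end Literature.NumberTheory.GaloisRepresentations

end
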